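import Summits.MatrixMultiplication.MatrixMultiplication.Theorems.SaturationLadderTransferLawRigidity
import HarnessLib

/-!
# Route `SaturationLadder` — the transfer law WITH DEFECT; onset floors = the format instance of the irreversibility barrier
(decomp-mm lens 1 «grading / quantitative ladder», gen 28; route-free helper: imports NO `Theses` file)

Gen 27 derived, for an EXACT single-base certificate `⟨p^{a'},p^{b'},p^{c'}⟩^{⊠N} ⊵ ⟨t⟩ ⊗ ⟨q^a,q^b,q^c⟩`
(`U := (N·ω(a',b',c')·log p − log t)/log q ≤ a + c`), bilinear LAWS in `ℕ` (`b·a' ≤ a·b'`, `b·c' ≤ c·b'`, …), the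
rigidity of the onset ladder and the propagation of the length floor.  Exact certificates are a measure-zero event —
a format is TIGHT when the INFIMUM of `U` is `a + c` — so this file (critic g27 r3) grades everything by the DEFECT
`d := U − (a+c)`: §1 the linear skeleton with defect (`d ≥ 0`; base `(dL/Y)`-tight; output packing saturated up to
`dL`; `(a'−b')Y ≤ (a−b+d)L`, `(c'−b')Y ≤ (c−b+d)L`; the input packings); §2 the laws with defect over `ℝ` for an
inner-bound base (`2b·a' ≤ 2a·b' + d(a'+b')`, `2b·c' ≤ 2c·b' + d(b'+c')`, excess and mixed laws, `b ≤ min(a,c) + d`);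
§3 INTEGRALITY: below the threshold `d₀(base) = min(1, 2/(a'+b'), 2/(b'+c'))` the exact `ℕ`-laws, the class invariant
`J₃` and the length floor already hold — they are OPEN conditions in the defect, hence (`laws_of_defectInfimum`) govern
the single-base TIGHTNESS-TRANSFER class (defects `→ 0` from one base), not only exact certificates; §4 ONSET FLOORS
in the currency `U`: for cube targets `4a'b ≤ (a'+b')U`, `4c'b ≤ (b'+c')U`, `2b(a'+c') ≤ (a'+b')U`,
`2b(a'+c') ≤ (b'+c')U` — the last two are the value `2·i = 2(a'+c')/(b' + min(a',c'))` of the catalogued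
IRREVERSIBILITY BARRIER (`CVZ2021_thm9`, proved in the tree) for a format base, in the route's certificate currency:
every landed flat witness and every far format `(k,1,1)`, `k ≥ 2`, certifies NO `ω < 3` (`cubeTarget_useless`; the
in-class price of `E₂` is the whole unit, against `1/4` by symmetrisation); for the level-two target every base with
`c' ≥ 3b'` is useless (`U ≥ 4b`).  Placement: §4 is INSIDE the barrier's class (one fixed intermediate tensor, CVZ
Thm. 9 / §3.1) and reproduces its value; §§2–3 are finer than the class allows for RECTANGULAR endings (CVZ Cor. 11
symmetrises through `cyc t`, a cube format, and obstructs nothing there — catalogue evasion (vi)): the ORIENTED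
single-base class is format-monotone.  Support module beneath stmt-MatrixMultiplication-25909; closes no item;
0 sorry; no definitions; imports only BUILT modules.
[cite: ChristandlLeGallLysikovZuiddam2020, Thm. 3.10 and Lemma 4.1; ChristandlVranaZuiddam2021, Thm. 9, §3.1, §3.2
and Cor. 11; ChristandlVranaZuiddam2023, Example 1.4; LottiRomani1983, §1 (p. 173); AlmanDuanVassilevskaWilliamsXuXuZhou2025, §3.4]
-/

set_option linter.dupNamespace false

noncomputable section

open scoped BigOperators

namespace Summit.MatrixMultiplication.MatrixMultiplication.Theorems.SaturationLadderTransferLawDefect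

open Literature.Computability.AlgebraicComplexity
open Literature.Barriers.MatrixMultiplication
open Summit.MatrixMultiplication.MatrixMultiplication.Theorems.SaturationLadderTransferLaw
  (logPacking₁ logPacking₂ logPacking₃ bilinear_of_interval)  -- landed, imported
open Summit.MatrixMultiplication.MatrixMultiplication.Theorems.SaturationLadderTransferLawRigidity
  (lengthFloor_transfer farBase_innerSquareTarget_floor)  -- landed, imported

variable {K : Type} [Field K]

/-! ## 0. Tight formats are inner-bound -/

/-- A tight format `ω(a',b',c') = a' + c'` is inner-bound: `b' ≤ a'`, `b' ≤ c'` (the two other information bounds).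
[cite: LottiRomani1983, §1 (p. 173)] -/
theorem innerBound_of_tight {a' b' c' : ℕ} (hT : omegaRect K a' b' c' = ((a' + c' : ℕ) : ℝ)) :
    b' ≤ a' ∧ b' ≤ c' := by
  have h12 := add_le_omegaRect₁₂ K (a' : ℝ) b' c'
  have h23 := add_le_omegaRect₂₃ K (a' : ℝ) b' c'
  rw [hT] at h12 h23
  push_cast at h12 h23
  exact ⟨by exact_mod_cast (by linarith : (b' : ℝ) ≤ a'), by exact_mod_cast (by linarith : (b' : ℝ) ≤ c')⟩

/-! ## 1. The linear skeleton of a certificate with defect `d` -/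

section Defect

variable {p a' b' c' N t q a b c : ℕ} {d : ℝ} (hp : 2 ≤ p) (hq : 2 ≤ q) (ht : 1 ≤ t)
  (h : PolyDegeneratesTo (kroneckerPow (matMulTensor K (p ^ a') (p ^ b') (p ^ c')) N)
    (kroneckerTensor (unitTensor K t) (matMulTensor K (q ^ a) (q ^ b) (q ^ c))))
  (hac : 1 ≤ a + c)
  (hU : ((N : ℝ) * (omegaRect K a' b' c' * Real.log p) - Real.log t) / Real.log q ≤ ((a + c : ℕ) : ℝ) + d)
include hp hq ht h hac hU

/-- **The linear skeleton of a certificate with defect `d`** (`U ≤ a + c + d`, `a + c ≥ 1`; `Y = N log p`,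
`L = log q`): `Y > 0`, `L > 0`, `log t ≥ 0`, **`d ≥ 0`** (a certificate never beats the information bound);
the base is near-tight, `ω'·Y ≤ (a'+c')·Y + d·L`; the output-leg packing is saturated up to the defect,
`(a'+c')Y ≤ log t + (a+c+d)L` (and `log t + (a+c)L ≤ (a'+c')Y`); the inner-excess bounds
`(a'−b')Y ≤ (a−b+d)L`, `(c'−b')Y ≤ (c−b+d)L`; the input-leg packings `(a+b)L ≤ (a'+b')Y`, `(b+c)L ≤ (b'+c')Y`.
[cite: ChristandlLeGallLysikovZuiddam2020, Thm. 3.10 and Lemma 4.1; LottiRomani1983, §1 (p. 173)] -/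
theorem defect_skeleton :
    0 < (N : ℝ) * Real.log p ∧ 0 < Real.log q ∧ 0 ≤ Real.log t ∧ 0 ≤ d ∧
    omegaRect K a' b' c' * ((N : ℝ) * Real.log p) ≤
      ((a' : ℝ) + c') * ((N : ℝ) * Real.log p) + d * Real.log q ∧
    ((a' : ℝ) + c') * ((N : ℝ) * Real.log p) ≤ Real.log t + ((a : ℝ) + c + d) * Real.log q ∧
    Real.log t + ((a : ℝ) + c) * Real.log q ≤ ((a' : ℝ) + c') * ((N : ℝ) * Real.log p) ∧
    ((a' : ℝ) - b') * ((N : ℝ) * Real.log p) ≤ ((a : ℝ) - b + d) * Real.log q ∧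
    ((c' : ℝ) - b') * ((N : ℝ) * Real.log p) ≤ ((c : ℝ) - b + d) * Real.log q ∧
    ((a : ℝ) + b) * Real.log q ≤ ((a' : ℝ) + b') * ((N : ℝ) * Real.log p) ∧
    ((b : ℝ) + c) * Real.log q ≤ ((b' : ℝ) + c') * ((N : ℝ) * Real.log p) := by
  have hq1 : (1 : ℝ) < q := by exact_mod_cast (by omega : 1 < q)
  have hL : 0 < Real.log q := Real.log_pos hq1
  have hp1 : (1 : ℝ) < p := by exact_mod_cast (by omega : 1 < p)
  have hlogp : 0 < Real.log p := Real.log_pos hp1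
  have ht1 : (1 : ℝ) ≤ t := by exact_mod_cast ht
  have hlogt : 0 ≤ Real.log t := Real.log_nonneg ht1
  have hN0 : (0 : ℝ) ≤ N := Nat.cast_nonneg N
  have hacR : (1 : ℝ) ≤ (a : ℝ) + c := by exact_mod_cast hac
  have l1 := logPacking₁ (K := K) hp hq ht h
  have l2 := logPacking₂ (K := K) hp hq ht h
  have l3 := logPacking₃ (K := K) hp hq ht h
  have hUL := (div_le_iff₀ hL).1 hU
  have hω := add_le_omegaRect₁₃ K (a' : ℝ) b' c'
  push_cast at l1 l2 l3 hUL hω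
  -- `N ≥ 1`: the right-hand side of the output-leg packing is positive
  have hN1 : (1 : ℝ) ≤ N := by
    rcases Nat.eq_zero_or_pos N with h0 | h0
    · exfalso; subst h0; push_cast at l1; nlinarith
    · exact_mod_cast h0
  have hY : 0 < (N : ℝ) * Real.log p := by nlinarith
  -- `(a'+c')·Y ≤ ω'·Y ≤ log t + (a+c+d)L`
  have hωY : ((a' : ℝ) + c') * ((N : ℝ) * Real.log p) ≤ omegaRect K a' b' c' * ((N : ℝ) * Real.log p) :=
    mul_le_mul_of_nonneg_right hω hY.le
  have e : (N : ℝ) * (omegaRect K a' b' c' * Real.log p) = omegaRect K a' b' c' * ((N : ℝ) * Real.log p) := by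
    ring
  rw [e] at hUL
  have hdL : 0 ≤ d * Real.log q := by nlinarith
  have hd : 0 ≤ d := nonneg_of_mul_nonneg_left hdL hL
  refine ⟨hY, hL, hlogt, hd, by linarith, by linarith, by linarith, by linarith, by linarith, by linarith,
    by linarith⟩

/-- **The base of a certificate with defect `d` is `(d·L/Y)`-tight**: `(ω(a',b',c') − (a'+c'))·N log p ≤ d·log q`
(gen 26 `base_nearTight_of_nearExact` in additive form). [cite: LottiRomani1983, §1 (p. 173); ChristandlLeGallLysikovZuiddam2020, Thm. 3.10] -/
theorem defect_base_nearTight :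
    (omegaRect K a' b' c' - ((a' : ℝ) + c')) * ((N : ℝ) * Real.log p) ≤ d * Real.log q := by
  obtain ⟨-, -, -, -, hnear, -⟩ := defect_skeleton hp hq ht h hac hU
  nlinarith

/-! ## 2. The laws with defect (inner-bound base) -/

/-- **THINNESS LAW with defect**: `2b·a' ≤ 2a·b' + d·(a'+b')` — the ratio `a/b` may fall below `a'/b'` only by
paying defect. [cite: ChristandlLeGallLysikovZuiddam2020, Thm. 3.10 and Lemma 4.1] -/
theorem defect_thinness_law (hba' : b' ≤ a') :
    2 * (b : ℝ) * a' ≤ 2 * (a : ℝ) * b' + d * ((a' : ℝ) + b') := by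
  obtain ⟨hY, hL, -, -, -, -, -, e3, -, p2, -⟩ := defect_skeleton hp hq ht h hac hU
  have hba'R : (b' : ℝ) ≤ a' := by exact_mod_cast hba'
  have key := bilinear_of_interval hL (by linarith) (by positivity) p2 e3
  nlinarith [key]

/-- **LENGTH LAW with defect**: `2b·c' ≤ 2c·b' + d·(b'+c')`. [cite: ChristandlLeGallLysikovZuiddam2020, Thm. 3.10 and Lemma 4.1] -/
theorem defect_length_law (hbc' : b' ≤ c') :
    2 * (b : ℝ) * c' ≤ 2 * (c : ℝ) * b' + d * ((b' : ℝ) + c') := by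
  obtain ⟨hY, hL, -, -, -, -, -, -, e2, -, p3⟩ := defect_skeleton hp hq ht h hac hU
  have hbc'R : (b' : ℝ) ≤ c' := by exact_mod_cast hbc'
  have key := bilinear_of_interval hL (by linarith) (by positivity) p3 e2
  nlinarith [key]

/-- **EXCESS LAWS with defect**: `(a'−b')(a+c) ≤ (a'+c')(a−b+d)` and `(c'−b')(a+c) ≤ (a'+c')(c−b+d)`.
[cite: ChristandlLeGallLysikovZuiddam2020, Thm. 3.10 and Lemma 4.1] -/
theorem defect_excess_laws (hba' : b' ≤ a') (hbc' : b' ≤ c') :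
    ((a' : ℝ) - b') * ((a : ℝ) + c) ≤ ((a' : ℝ) + c') * ((a : ℝ) - b + d) ∧
    ((c' : ℝ) - b') * ((a : ℝ) + c) ≤ ((a' : ℝ) + c') * ((c : ℝ) - b + d) := by
  obtain ⟨hY, hL, hlogt, -, -, -, q1, e3, e2, -, -⟩ := defect_skeleton hp hq ht h hac hU
  have hba'R : (b' : ℝ) ≤ a' := by exact_mod_cast hba'
  have hbc'R : (b' : ℝ) ≤ c' := by exact_mod_cast hbc'
  have p1 : ((a : ℝ) + c) * Real.log q ≤ ((a' : ℝ) + c') * ((N : ℝ) * Real.log p) := by linarith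
  exact ⟨bilinear_of_interval hL (by linarith) (by positivity) p1 e3,
    bilinear_of_interval hL (by linarith) (by positivity) p1 e2⟩

/-- **MIXED LAWS with defect**: `(c'−b')(a+b) ≤ (a'+b')(c−b+d)` and `(a'−b')(b+c) ≤ (b'+c')(a−b+d)`.
[cite: ChristandlLeGallLysikovZuiddam2020, Thm. 3.10 and Lemma 4.1] -/
theorem defect_mixed_laws (hba' : b' ≤ a') (hbc' : b' ≤ c') :
    ((c' : ℝ) - b') * ((a : ℝ) + b) ≤ ((a' : ℝ) + b') * ((c : ℝ) - b + d) ∧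
    ((a' : ℝ) - b') * ((b : ℝ) + c) ≤ ((b' : ℝ) + c') * ((a : ℝ) - b + d) := by
  obtain ⟨hY, hL, -, -, -, -, -, e3, e2, p2, p3⟩ := defect_skeleton hp hq ht h hac hU
  have hba'R : (b' : ℝ) ≤ a' := by exact_mod_cast hba'
  have hbc'R : (b' : ℝ) ≤ c' := by exact_mod_cast hbc'
  exact ⟨bilinear_of_interval hL (by linarith) (by positivity) p2 e2,
    bilinear_of_interval hL (by linarith) (by positivity) p3 e3⟩

/-- **The target is inner-bound up to the defect**: `b ≤ a + d`, `b ≤ c + d`. [cite: LottiRomani1983, §1 (p. 173)] -/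
theorem defect_target_inner (hba' : b' ≤ a') (hbc' : b' ≤ c') :
    (b : ℝ) ≤ a + d ∧ (b : ℝ) ≤ c + d := by
  obtain ⟨hY, hL, -, -, -, -, -, e3, e2, -, -⟩ := defect_skeleton hp hq ht h hac hU
  have hba'R : (b' : ℝ) ≤ a' := by exact_mod_cast hba'
  have hbc'R : (b' : ℝ) ≤ c' := by exact_mod_cast hbc'
  have h1 : 0 ≤ ((a : ℝ) - b + d) * Real.log q := le_trans (mul_nonneg (by linarith) hY.le) e3
  have h2 : 0 ≤ ((c : ℝ) - b + d) * Real.log q := le_trans (mul_nonneg (by linarith) hY.le) e2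
  have h1' : (0 : ℝ) ≤ (a : ℝ) - b + d := nonneg_of_mul_nonneg_left h1 hL
  have h2' : (0 : ℝ) ≤ (c : ℝ) - b + d := nonneg_of_mul_nonneg_left h2 hL
  exact ⟨by linarith, by linarith⟩

/-! ## 3. Integrality: the exact laws hold below the defect threshold `d₀(base)` -/

/-- **THINNESS LAW below threshold**: `d·(a'+b') < 2` ⟹ `b·a' ≤ a·b'` in `ℕ` — the exact law of gen 27 is an
OPEN condition in the defect. [cite: ChristandlLeGallLysikovZuiddam2020, Thm. 3.10 and Lemma 4.1] -/
theorem thinness_law_of_smallDefect (hba' : b' ≤ a') (hd : d * ((a' : ℝ) + b') < 2) : b * a' ≤ a * b' := by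
  have h1 := defect_thinness_law hp hq ht h hac hU hba'
  have h3 : b * a' < a * b' + 1 := by exact_mod_cast (by push_cast; linarith : ((b * a' : ℕ) : ℝ) < ((a * b' + 1 : ℕ) : ℝ))
  omega

/-- **LENGTH LAW below threshold**: `d·(b'+c') < 2` ⟹ `b·c' ≤ c·b'` in `ℕ`. [cite: ChristandlLeGallLysikovZuiddam2020, Thm. 3.10 and Lemma 4.1] -/
theorem length_law_of_smallDefect (hbc' : b' ≤ c') (hd : d * ((b' : ℝ) + c') < 2) : b * c' ≤ c * b' := by
  have h1 := defect_length_law hp hq ht h hac hU hbc'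
  have h3 : b * c' < c * b' + 1 := by exact_mod_cast (by push_cast; linarith : ((b * c' : ℕ) : ℝ) < ((c * b' + 1 : ℕ) : ℝ))
  omega

/-- **Inner-bound target below threshold**: `d < 1` ⟹ `b ≤ a`, `b ≤ c`. [cite: LottiRomani1983, §1 (p. 173)] -/
theorem target_inner_of_smallDefect (hba' : b' ≤ a') (hbc' : b' ≤ c') (hd : d < 1) : b ≤ a ∧ b ≤ c := by
  obtain ⟨h1, h2⟩ := defect_target_inner hp hq ht h hac hU hba' hbc'
  have h1' : b < a + 1 := by exact_mod_cast (by push_cast; linarith : ((b : ℕ) : ℝ) < ((a + 1 : ℕ) : ℝ))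
  have h2' : b < c + 1 := by exact_mod_cast (by push_cast; linarith : ((b : ℕ) : ℝ) < ((c + 1 : ℕ) : ℝ))
  omega

/-- **The length floor propagates along every certificate of small defect** (gen 27 `lengthFloor_transfer` fed by
the laws below threshold): base floor `log 4 · b'/(a'−b') ≤ log((a'+c')/b') + 1 − log 2` (`1 ≤ b' < a'`, `b' ≤ c'`),
target `b ≥ 1`, `d·(a'+b') < 2`, `d·(b'+c') < 2` ⟹ `b < a` and the same floor at the target. [folklore] -/
theorem lengthFloor_of_smallDefect (hb : 1 ≤ b) (hb' : 1 ≤ b') (hab' : b' < a') (hbc' : b' ≤ c')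
    (hd₂ : d * ((a' : ℝ) + b') < 2) (hd₃ : d * ((b' : ℝ) + c') < 2)
    (hfloor : Real.log 4 * ((b' : ℝ) / ((a' : ℝ) - b')) ≤ Real.log (((a' : ℝ) + c') / b') + 1 - Real.log 2) :
    b < a ∧ Real.log 4 * ((b : ℝ) / ((a : ℝ) - b)) ≤ Real.log (((a : ℝ) + c) / b) + 1 - Real.log 2 :=
  lengthFloor_transfer hb hb' hab' (thinness_law_of_smallDefect hp hq ht h hac hU hab'.le hd₂)
    (length_law_of_smallDefect hp hq ht h hac hU hbc' hd₃) hfloor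

/-- **The class invariant `J₃` (`b < c ∨ (c = b ∧ 3b ≤ a)`) propagates along every certificate of small defect**
(`d < 1`, `d(a'+b') < 2`, `d(b'+c') < 2`; inner-bound base): gen 27 `exact_classInvariant` is an open condition —
the level-two format `(2,1,1)` and the cube stay outside the closure of the flat catalogue under sums and
NEAR-exact single-base transfers. [cite: ChristandlLeGallLysikovZuiddam2020, Thm. 3.10 and Lemma 4.1; LottiRomani1983, §1 (p. 173)] -/
theorem classInvariant_of_smallDefect (hba' : b' ≤ a') (hbc' : b' ≤ c') (hd₁ : d < 1)
    (hd₂ : d * ((a' : ℝ) + b') < 2) (hd₃ : d * ((b' : ℝ) + c') < 2)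
    (hJ : b' < c' ∨ (c' = b' ∧ 3 * b' ≤ a')) : b < c ∨ (c = b ∧ 3 * b ≤ a) := by
  obtain ⟨-, hbc⟩ := target_inner_of_smallDefect hp hq ht h hac hU hba' hbc' hd₁
  have hthin := thinness_law_of_smallDefect hp hq ht h hac hU hba' hd₂
  have hlen := length_law_of_smallDefect hp hq ht h hac hU hbc' hd₃
  obtain ⟨-, hY, hL, -, -, -, -, -, -, -, p3⟩ := defect_skeleton hp hq ht h hac hU
  rcases Nat.eq_zero_or_pos b with hb0 | hb0
  · subst hb0
    rcases Nat.eq_zero_or_pos c with hc0 | hc0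
    · exact Or.inr ⟨hc0, by omega⟩
    · exact Or.inl hc0
  rcases hbc.lt_or_eq with hlt | heq
  · exact Or.inl hlt
  refine Or.inr ⟨heq.symm, ?_⟩
  rcases hJ with hJ | ⟨hc', h3⟩
  · rw [← heq] at hlen
    have := Nat.le_of_mul_le_mul_left hlen hb0
    omega
  · rcases Nat.eq_zero_or_pos b' with hb'0 | hb'0
    · exfalso
      rw [(by exact_mod_cast hb'0 : (b' : ℝ) = 0), (by exact_mod_cast (hc'.trans hb'0) : (c' : ℝ) = 0)] at p3
      nlinarith [(by exact_mod_cast hb0 : (1 : ℝ) ≤ b), (Nat.cast_nonneg c : (0 : ℝ) ≤ c)]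
    · have h1 : 3 * b * b' ≤ a * b' :=
        calc 3 * b * b' = b * (3 * b') := by ring
          _ ≤ b * a' := Nat.mul_le_mul_left b h3
          _ ≤ a * b' := hthin
      exact Nat.le_of_mul_le_mul_right h1 hb'0

end Defect

/-- **The laws govern the TIGHTNESS-TRANSFER class.**  If ONE inner-bound base format `⟨p^{a'},p^{b'},p^{c'}⟩`
certifies the target format `(a,b,c)` with defects arbitrarily close to `0` (this is what «`(a,b,c)` is made tight
by transfer from that base» means — exact certificates are a measure-zero event), then the exact laws of gen 27
hold: `b·a' ≤ a·b'`, `b·c' ≤ c·b'`, `b ≤ a`, `b ≤ c`.  Hence the onset rigidity (`exact_innerSquareTarget`,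
`exact_cubeTarget_base_cube`, `exact_classInvariant`) and the length floor (`lengthFloor_transfer`) constrain the
whole in-class closure of the flat catalogue, in the infimum. [cite: ChristandlLeGallLysikovZuiddam2020, Thm. 3.10 and Lemma 4.1] -/
theorem laws_of_defectInfimum {a' b' c' a b c : ℕ} (hba' : b' ≤ a') (hbc' : b' ≤ c') (hac : 1 ≤ a + c)
    (hfam : ∀ δ : ℝ, 0 < δ → ∃ p N t q : ℕ, 2 ≤ p ∧ 2 ≤ q ∧ 1 ≤ t ∧
      PolyDegeneratesTo (kroneckerPow (matMulTensor K (p ^ a') (p ^ b') (p ^ c')) N)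
        (kroneckerTensor (unitTensor K t) (matMulTensor K (q ^ a) (q ^ b) (q ^ c))) ∧
      ((N : ℝ) * (omegaRect K a' b' c' * Real.log p) - Real.log t) / Real.log q ≤ ((a + c : ℕ) : ℝ) + δ) :
    b * a' ≤ a * b' ∧ b * c' ≤ c * b' ∧ b ≤ a ∧ b ≤ c := by
  have hS : (0 : ℝ) < (a' : ℝ) + b' + c' + 2 := by positivity
  obtain ⟨p, N, t, q, hp, hq, ht, h, hU⟩ := hfam (1 / ((a' : ℝ) + b' + c' + 2)) (by positivity)
  have hδ1 : 1 / ((a' : ℝ) + b' + c' + 2) * ((a' : ℝ) + b' + c' + 2) = 1 := by field_simp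
  have hb' : (0 : ℝ) ≤ b' := Nat.cast_nonneg b'
  have hd₁ : 1 / ((a' : ℝ) + b' + c' + 2) < 1 := by rw [div_lt_one hS]; linarith
  have hd₂ : 1 / ((a' : ℝ) + b' + c' + 2) * ((a' : ℝ) + b') < 2 := by nlinarith [Nat.cast_nonneg (α := ℝ) c']
  have hd₃ : 1 / ((a' : ℝ) + b' + c' + 2) * ((b' : ℝ) + c') < 2 := by nlinarith [Nat.cast_nonneg (α := ℝ) a']
  exact ⟨thinness_law_of_smallDefect hp hq ht h hac hU hba' hd₂,
    length_law_of_smallDefect hp hq ht h hac hU hbc' hd₃,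
    target_inner_of_smallDefect hp hq ht h hac hU hba' hbc' hd₁⟩

/-! ## 4. Onset floors in the certificate's currency: the format instance of the irreversibility barrier -/

section Onset

variable {p a' b' c' N t q : ℕ}

/-- **Cube targets.**  Every certificate `⟨p^{a'},p^{b'},p^{c'}⟩^{⊠N} ⊵ ⟨t⟩ ⊗ ⟨q^b,q^b,q^b⟩` from an
inner-bound base (`b' ≤ a'`, `b' ≤ c'`; `b ≥ 1`) has certified exponent `U = (N·ω'·log p − log t)/log q` with
`4a'·b ≤ (a'+b')·U`, `4c'·b ≤ (b'+c')·U`, `2b·(a'+c') ≤ (a'+b')·U`, `2b·(a'+c') ≤ (b'+c')·U`.  The last two say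
`U/b ≥ 2(a'+c')/(b' + min(a',c')) = 2·log R̃/log Q̃` evaluated with `R̃ ≥ p^{a'+c'}`, `Q̃ = p^{b'+min(a',c')}`: the
value of the irreversibility barrier (CVZ Thm. 9, proved in the tree as `CVZ2021_thm9_holds`) for a FORMAT base,
here in the route's certificate currency; it exceeds `2` for every non-cube base.
[cite: ChristandlVranaZuiddam2021, Thm. 9 and §3.1; ChristandlLeGallLysikovZuiddam2020, Thm. 3.10 and Lemma 4.1] -/
theorem cubeTarget_floor {b : ℕ} (hp : 2 ≤ p) (hq : 2 ≤ q) (ht : 1 ≤ t) (hb : 1 ≤ b)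
    (hba' : b' ≤ a') (hbc' : b' ≤ c')
    (h : PolyDegeneratesTo (kroneckerPow (matMulTensor K (p ^ a') (p ^ b') (p ^ c')) N)
      (kroneckerTensor (unitTensor K t) (matMulTensor K (q ^ b) (q ^ b) (q ^ b)))) :
    4 * (a' : ℝ) * b ≤ ((a' : ℝ) + b') *
      (((N : ℝ) * (omegaRect K a' b' c' * Real.log p) - Real.log t) / Real.log q) ∧
    4 * (c' : ℝ) * b ≤ ((b' : ℝ) + c') *
      (((N : ℝ) * (omegaRect K a' b' c' * Real.log p) - Real.log t) / Real.log q) ∧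
    2 * (b : ℝ) * ((a' : ℝ) + c') ≤ ((a' : ℝ) + b') *
      (((N : ℝ) * (omegaRect K a' b' c' * Real.log p) - Real.log t) / Real.log q) ∧
    2 * (b : ℝ) * ((a' : ℝ) + c') ≤ ((b' : ℝ) + c') *
      (((N : ℝ) * (omegaRect K a' b' c' * Real.log p) - Real.log t) / Real.log q) := by
  have hU : ((N : ℝ) * (omegaRect K a' b' c' * Real.log p) - Real.log t) / Real.log q ≤
      ((b + b : ℕ) : ℝ) +
        ((((N : ℝ) * (omegaRect K a' b' c' * Real.log p) - Real.log t) / Real.log q) - 2 * b) := by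
    push_cast; linarith
  have hac : 1 ≤ b + b := by omega
  have h1 := defect_thinness_law hp hq ht h hac hU hba'
  have h2 := defect_length_law hp hq ht h hac hU hbc'
  obtain ⟨h3, h4⟩ := defect_mixed_laws hp hq ht h hac hU hba' hbc'
  refine ⟨by nlinarith [h1], by nlinarith [h2], by nlinarith [h3], by nlinarith [h4]⟩

/-- **Useless bases for the summit.**  If `3b' ≤ a'` or `3b' ≤ c'` or `c' + 3b' ≤ 2a'` or `a' + 3b' ≤ 2c'`
(base inner-bound with `b' ≥ 1`), a certificate from `⟨p^{a'},p^{b'},p^{c'}⟩^{⊠N}` for a cube `⟨q^b⟩³` (`b ≥ 1`)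
certifies `U ≥ 3b` — NOTHING below the trivial exponent `3`.  This covers every landed flat witness (X-perfect,
near-square `7b' ≤ 2a'`, `(3,1,4)`, …) and every far format `(k,1,1)`, `k ≥ 2`: in particular the level-two format
`(2,1,1)` (`c' + 3b' = 4 ≤ 2a'`) — the in-class price of `E₂` for the summit is the whole unit, against `1/4` by
symmetrisation (`SquareFromTwo`, gen 7). [cite: ChristandlVranaZuiddam2021, Thm. 9 and §3.1] -/
theorem cubeTarget_useless {b : ℕ} (hp : 2 ≤ p) (hq : 2 ≤ q) (ht : 1 ≤ t) (hb : 1 ≤ b) (hb' : 1 ≤ b')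
    (hba' : b' ≤ a') (hbc' : b' ≤ c')
    (hbase : 3 * b' ≤ a' ∨ 3 * b' ≤ c' ∨ c' + 3 * b' ≤ 2 * a' ∨ a' + 3 * b' ≤ 2 * c')
    (h : PolyDegeneratesTo (kroneckerPow (matMulTensor K (p ^ a') (p ^ b') (p ^ c')) N)
      (kroneckerTensor (unitTensor K t) (matMulTensor K (q ^ b) (q ^ b) (q ^ b)))) :
    3 * (b : ℝ) ≤ ((N : ℝ) * (omegaRect K a' b' c' * Real.log p) - Real.log t) / Real.log q := by
  obtain ⟨h1, h2, h3, h4⟩ := cubeTarget_floor hp hq ht hb hba' hbc' h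
  set U := ((N : ℝ) * (omegaRect K a' b' c' * Real.log p) - Real.log t) / Real.log q with hUdef
  have hbR : (1 : ℝ) ≤ b := by exact_mod_cast hb
  have hb'R : (1 : ℝ) ≤ b' := by exact_mod_cast hb'
  have hba'R : (b' : ℝ) ≤ a' := by exact_mod_cast hba'
  have hbc'R : (b' : ℝ) ≤ c' := by exact_mod_cast hbc'
  by_contra hlt
  have hlt := not_le.mp hlt
  have k₂ := mul_lt_mul_of_pos_left hlt (by linarith : (0 : ℝ) < (a' : ℝ) + b')
  have k₃ := mul_lt_mul_of_pos_left hlt (by linarith : (0 : ℝ) < (b' : ℝ) + c')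
  rcases hbase with hA | hC | hAC | hCA
  · have hAR : 3 * (b' : ℝ) ≤ a' := by exact_mod_cast hA
    nlinarith [mul_le_mul_of_nonneg_right hAR (by linarith : (0 : ℝ) ≤ b)]
  · have hCR : 3 * (b' : ℝ) ≤ c' := by exact_mod_cast hC
    nlinarith [mul_le_mul_of_nonneg_right hCR (by linarith : (0 : ℝ) ≤ b)]
  · have hACR : (c' : ℝ) + 3 * b' ≤ 2 * a' := by exact_mod_cast hAC
    nlinarith [mul_le_mul_of_nonneg_right hACR (by linarith : (0 : ℝ) ≤ b)]
  · have hCAR : (a' : ℝ) + 3 * b' ≤ 2 * c' := by exact_mod_cast hCA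
    nlinarith [mul_le_mul_of_nonneg_right hCAR (by linarith : (0 : ℝ) ≤ b)]

/-- **Level-two targets.**  Every certificate from an inner-bound base for the inner-square format
`⟨q^a,q^b,q^b⟩` (`a + b ≥ 1`) has `a(b'+c') + b(3c'−b') ≤ (b'+c')·U` (length law) and `(a+b)(a'+c') ≤ (a'+b')·U`
(mixed law = the `ζ⁽²⁾`-floor at a tight base).  Numbers for the level-two target `a = 2b`: base `(3,1,4)`:
`U ≥ max(21/5, 21/4)·b = 5.25b`; `(5,1,3)`: `U ≥ 4b`; near-square `(a',b',a')`, `7b' ≤ 2a'`: `U ≥ (2 + 19/9)b`;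
`(2,1,9)`: `4.6b`; `(19,8,45)`: `4.40b` — all `≥ 4b`, the trivial exponent of `⟨q^{2b},q^b,q^b⟩`; the short X-perfect
format `(20,1,2)` (`q₀ = 22`) keeps `U ≥ 11b/3` only. [cite: ChristandlLeGallLysikovZuiddam2020, Thm. 3.10 and Lemma 4.1; ChristandlVranaZuiddam2021, §3.2 and Cor. 11] -/
theorem innerSquareTarget_floor {a b : ℕ} (hp : 2 ≤ p) (hq : 2 ≤ q) (ht : 1 ≤ t) (hab : 1 ≤ a + b)
    (hba' : b' ≤ a') (hbc' : b' ≤ c')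
    (h : PolyDegeneratesTo (kroneckerPow (matMulTensor K (p ^ a') (p ^ b') (p ^ c')) N)
      (kroneckerTensor (unitTensor K t) (matMulTensor K (q ^ a) (q ^ b) (q ^ b)))) :
    (a : ℝ) * ((b' : ℝ) + c') + (b : ℝ) * (3 * (c' : ℝ) - b') ≤ ((b' : ℝ) + c') *
      (((N : ℝ) * (omegaRect K a' b' c' * Real.log p) - Real.log t) / Real.log q) ∧
    ((a : ℝ) + b) * ((a' : ℝ) + c') ≤ ((a' : ℝ) + b') *
      (((N : ℝ) * (omegaRect K a' b' c' * Real.log p) - Real.log t) / Real.log q) := by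
  have hU : ((N : ℝ) * (omegaRect K a' b' c' * Real.log p) - Real.log t) / Real.log q ≤
      ((a + b : ℕ) : ℝ) +
        ((((N : ℝ) * (omegaRect K a' b' c' * Real.log p) - Real.log t) / Real.log q) - (a + b)) := by
    push_cast; linarith
  have h2 := defect_length_law hp hq ht h hab hU hbc'
  obtain ⟨h3, -⟩ := defect_mixed_laws hp hq ht h hab hU hba' hbc'
  refine ⟨by nlinarith [h2], by nlinarith [h3]⟩

/-- **Long bases are useless for the level-two format**: `c' ≥ 3b'` (`1 ≤ b' ≤ a'`) ⟹ `U ≥ 4b` for the target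
`⟨q^{2b},q^b,q^b⟩` (`b ≥ 1`) — the trivial exponent; with gen 27 (`farBase_innerSquareTarget_floor`: far bases
`(k,1,1)`, `k ≥ 3`, give `U ≥ (k+1)b ≥ 4b`) the level-two format is certified non-trivially by NO landed flat witness
with `c' ≥ 3b'` and by no far format through single-base transfer. [cite: ChristandlLeGallLysikovZuiddam2020, Thm. 3.10 and Lemma 4.1] -/
theorem levelTwoTarget_useless_of_long_base {b : ℕ} (hp : 2 ≤ p) (hq : 2 ≤ q) (ht : 1 ≤ t) (hb : 1 ≤ b)
    (hb' : 1 ≤ b') (hba' : b' ≤ a') (hlong : 3 * b' ≤ c')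
    (h : PolyDegeneratesTo (kroneckerPow (matMulTensor K (p ^ a') (p ^ b') (p ^ c')) N)
      (kroneckerTensor (unitTensor K t) (matMulTensor K (q ^ (2 * b)) (q ^ b) (q ^ b)))) :
    4 * (b : ℝ) ≤ ((N : ℝ) * (omegaRect K a' b' c' * Real.log p) - Real.log t) / Real.log q := by
  obtain ⟨h1, -⟩ := innerSquareTarget_floor hp hq ht (by omega) hba' (by omega) h
  set U := ((N : ℝ) * (omegaRect K a' b' c' * Real.log p) - Real.log t) / Real.log q with hUdef
  have hlongR : 3 * (b' : ℝ) ≤ c' := by exact_mod_cast hlong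
  have hbR : (1 : ℝ) ≤ b := by exact_mod_cast hb
  have hb'R : (1 : ℝ) ≤ b' := by exact_mod_cast hb'
  have hS₃ : (0 : ℝ) < (b' : ℝ) + c' := by linarith
  have e : ((2 * b : ℕ) : ℝ) = 2 * (b : ℝ) := by push_cast; ring
  rw [e] at h1
  by_contra hlt
  have hlt := not_le.mp hlt
  have k₃ := mul_lt_mul_of_pos_left hlt hS₃
  nlinarith [mul_le_mul_of_nonneg_right hlongR (by linarith : (0 : ℝ) ≤ b)]

/-- **The level-two base is useless for the summit, quantitatively** (gen 27 `farBase_innerSquareTarget_floor` at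
`k = 2`, `a = b`): every certificate `⟨p²,p,p⟩^{⊠N} ⊵ ⟨t⟩ ⊗ ⟨q^b,q^b,q^b⟩` has `U ≥ b·ω(2,1,1) ≥ 3b`.  So the
declared residual `SquareFromTwo` (`E₂ ⟹ ω = 2`) is not merely inexact in-class (gen 27): in-class `E₂` buys NO bound
below `3`, while three bases (symmetrisation) buy `9/4`. [cite: ChristandlVranaZuiddam2021, Thm. 9 and §3.1; ChristandlLeGallLysikovZuiddam2020, Lemma 4.1] -/
theorem squareFromTwo_inClass_price {b : ℕ} (hp : 2 ≤ p) (hq : 2 ≤ q) (ht : 1 ≤ t)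
    (h : PolyDegeneratesTo (kroneckerPow (matMulTensor K (p ^ 2) (p ^ 1) (p ^ 1)) N)
      (kroneckerTensor (unitTensor K t) (matMulTensor K (q ^ b) (q ^ b) (q ^ b)))) :
    (b : ℝ) * (2 + 1) ≤ (b : ℝ) * omegaRect K 2 1 1 ∧
    (b : ℝ) * omegaRect K 2 1 1 ≤
      ((N : ℝ) * (omegaRect K 2 1 1 * Real.log p) - Real.log t) / Real.log q := by
  have := farBase_innerSquareTarget_floor (K := K) 2 (a := b) (b := b) hp hq ht h
  push_cast at this ⊢
  exact this

end Onset

end Summit.MatrixMultiplication.MatrixMultiplication.Theorems.SaturationLadderTransferLawDefect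

end
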